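import Literature.Analysis.FluidPDE.TorusNSSobolevCommutator
import Literature.Analysis.FluidPDE.TorusNSGevreySums
import Literature.Analysis.FunctionSpaces.TorusWienerSobolevInterpolation
import HarnessLib

/-!
# The `Ḣ^s` energy inequality and growth-rate law for classical Navier–Stokes solutions on
# `T³`, `1/2 < s < 3/2` (Robinson–Sadowski–Silva 2012, §IV)

Analysis/FluidPDE support file (theorems only; no definitions, no named facts).
Search for candidate a priori estimates; no regularity claim.

Robinson–Sadowski–Silva (J. Math. Phys. 53 (2012) 115618, §IV) take the inner product of the
(unforced, periodic) Navier–Stokes equations with `u` in `Ḣ^s`, `1/2 < s < 3/2`, and obtain from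
(3.5) and the interpolation (3.10)

  `½ d/dt ‖u‖_s² + ν‖u‖²_{s+1} ≤ c_s ‖u‖_s ‖u‖_{s+1} ‖u‖_F ≤ c_s ‖u‖_s^{s+1/2} ‖u‖_{s+1}^{5/2−s}`,

"Application of Young's inequality on the right-hand side yields
`d/dt ‖u‖_s² ≤ c_s ‖u‖_s^{2(2s+1)/(2s−1)}`, showing that the local existence time depends only on
the norm in `Ḣ^s`" and, by (4.2), the blow-up rate `‖u(T − t)‖_{Ḣ^s} ≥ c_s t^{−(2s−1)/4}`.
Here both displays are proved for classical solutions of `Torus.IsClassicalNSSolutionOn` with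
zero force and mean-zero slices on a window `[a, b] × T³` (`card d = 3`), at interior times, with
`‖u‖_s² = ∑_k |k|^{2s}‖û(k)‖²` in the tree's normalisation `|k|² = freqNormSq k` (no `2π`), the
viscosity made explicit by scaling (`ν^{−(5−2s)/(2s−1)}`), and existential constants:

* `NSSobolev.hasDerivAt_tsum_rpow_mul_norm_sq` — for a field jointly smooth on `[a,b] × T^n`,
  `s > 0` and `n < 8 − 2s`, the full Sobolev sum `t ↦ ∑_k |k|^{2s}‖û(t,k)‖²` is differentiable at
  interior times with derivative `∑_k |k|^{2s} 2Re⟪𝓕(∂ₜu)(k), û(k)⟫` (termwise differentiation,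
  `hasDerivAt_tsum_of_isPreconnected`, dominated through the uniform `H⁴` bound of the window);
* `NSSobolev.hsSeminorm_sq_deriv_le` — **the `Ḣ^s` energy inequality**:
  `d/dt ‖u‖_s² ≤ −8π²ν ‖u‖²_{s+1} + K ‖u‖_s^{s+1/2} ‖u‖_{s+1}^{5/2−s}`;
* `NSSobolev.hsSeminorm_sq_deriv_le_rpow` — **the rate law**:
  `d/dt ‖u‖_s² ≤ −4π²ν ‖u‖²_{s+1} + c ν^{−(5−2s)/(2s−1)} (‖u‖_s²)^{(2s+1)/(2s−1)}`.

Ingredients: the modewise energy identity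
`IsClassicalNSSolutionOn.re_inner_mFourierCoeff_timeDerivWithin` (pressure invisible), the
lattice form of (3.5) `NSSobolev.sum_rpow_mul_norm_mul_norm_convect_le` and Lemma 3.2 at `r = 0`,
`Torus.exists_tsum_rpow_mul_norm_le_interpolation` (`‖u‖_F ≤ C‖u‖_s^{s−1/2}‖u‖_{s+1}^{3/2−s}`),
and the weighted AM–GM inequality.

Extension (same file): `NSSobolev.hsSeminorm_sq_deriv_le_of_gt` — the case `3/2 < s < 5/2` of
the energy inequality via the commutator estimate (3.6) (`TorusNSSobolevCommutator`) and Lemma 3.2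
at `r = 1`; `NSSobolev.hsSeminorm_sq_deriv_le'`, `NSSobolev.hsSeminorm_sq_deriv_le_rpow'` — the
energy inequality and the rate law on the whole range `1/2 < s < 5/2`, `s ≠ 3/2` (RSS §IV: "We
obtain the same differential inequality when `3/2 < s < 5/2`").

## Mathlib / tree search

Tree: `NSGevrey.hasDerivWithinAt_norm_sq_mFourierCoeff`, `NSGevrey.hasSum_freqNormSq_sq_mul_norm_sq_mFourierCoeff`,
`Torus.IsSmoothSpaceTimeOn.exists_forall_integral_norm_laplacian_sq_le` (`TorusNSGevreySums`,
`TorusNSGevreyCoefficients`), `Torus.lqNorm_blowup_rate`/`Torus.hsSeminorm_blowup_rate` (the rates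
by the Leray–`L^q` route, `TorusNSSobolevBlowupRate`); Mathlib `hasDerivAt_tsum_of_isPreconnected`,
`Real.geom_mean_le_arith_mean2_weighted`. Searched `hsSeminorm.*deriv|Sobolev.*rate law|rpow_mul_norm_sq.*HasDerivAt`:
no `Ḣ^s` energy inequality for Navier–Stokes in the tree (integer orders: `Torus.enstrophy_balance`
& co. only).

## References

* J. C. Robinson, W. Sadowski, R. P. Silva, *Lower bounds on blow up solutions of the
  three-dimensional Navier–Stokes equations in homogeneous Sobolev spaces*, J. Math. Phys. 53
  (2012) 115618, §IV (4.1)–(4.2) and the displays following (held: paper:doi-10-1063-1-4762841,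
  pp. 9–10). [RobinsonSadowskiSilva2012]
* J. C. Robinson, J. L. Rodrigo, W. Sadowski, *The three-dimensional Navier–Stokes equations*,
  CUP 2016, Lemma 10.3 / Cor. 10.2 (the `Ḣ^s` energy estimates for `1/2 < s`). [RobinsonRodrigoSadowskiCUP2016]
-/

noncomputable section

open MeasureTheory Set Filter UnitAddTorus Function Finset
open scoped Topology BigOperators InnerProductSpace ComplexConjugate

namespace Literature.Analysis.FluidPDE

namespace NSSobolev

open Literature.Analysis.FunctionSpaces Literature.Analysis.FunctionSpaces.Torus NSGevrey

variable {d : Type*} [Fintype d] [DecidableEq d]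

/-! ### §1 Uniform decay of the slice coefficients on a compact time window -/

omit [DecidableEq d] in
/-- The punctured lattice `p`-series `∑_{k≠0} |k|^{-2t}` converges for `2t > n`
(`|k|^{-2t} ≤ 2^t (1+|k|²)^{-t}` off the origin). [folklore] -/
private theorem summable_ite_freqNormSq_rpow_neg {t : ℝ} (ht : (Fintype.card d : ℝ) < 2 * t) :
    Summable fun k : d → ℤ => if k = 0 then (0 : ℝ) else freqNormSq k ^ (-t) := by
  classical
  have ht0 : 0 ≤ t := by
    have : (0 : ℝ) ≤ Fintype.card d := Nat.cast_nonneg _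
    linarith
  rcases isEmpty_or_nonempty d with hd | hd
  · refine summable_of_ne_finset_zero (s := ∅) fun k _ => ?_
    rw [if_pos (Subsingleton.elim k 0)]
  have hmaj := (summable_one_add_freqNormSq_rpow_neg (d := d) ht).mul_left ((2 : ℝ) ^ t)
  refine Summable.of_nonneg_of_le (fun k => ?_) (fun k => ?_) hmaj
  · split_ifs
    · exact le_rfl
    · exact Real.rpow_nonneg (freqNormSq_nonneg k) _
  · split_ifs with hk
    · exact mul_nonneg (Real.rpow_nonneg (by norm_num) _)
        (Real.rpow_nonneg (by linarith [freqNormSq_nonneg k]) _)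
    · have hm : 1 ≤ freqNormSq k := one_le_freqNormSq_of_ne_zero hk
      have hm0 : 0 < freqNormSq k := by linarith
      have h2 : (freqNormSq k)⁻¹ ≤ 2 / (1 + freqNormSq k) := by
        rw [inv_eq_one_div, div_le_div_iff₀ hm0 (by linarith)]
        linarith
      calc freqNormSq k ^ (-t) = (freqNormSq k)⁻¹ ^ t := by
            rw [Real.rpow_neg hm0.le, Real.inv_rpow hm0.le]
        _ ≤ (2 / (1 + freqNormSq k)) ^ t := Real.rpow_le_rpow (inv_nonneg.2 hm0.le) h2 ht0
        _ = 2 ^ t * (1 + freqNormSq k) ^ (-t) := by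
            rw [Real.div_rpow (by norm_num) (by linarith), Real.rpow_neg (by linarith),
              div_eq_mul_inv]

/-- **Uniform `H⁴` decay on a compact window**: for a field `g` jointly smooth on `[a, b] × T^n`
there is `W` with `|k|⁸ ‖ĝ(τ, k)‖² ≤ W` for all `τ ∈ [a, b]` and all `k` (Parseval for `Δ²g(τ)`,
`NSGevrey.hasSum_freqNormSq_sq_mul_norm_sq_mFourierCoeff`, and the uniform bound of `∫‖Δ(Δg)‖²`
on the window). [cite: RobinsonSadowskiSilva2012, §IV (regularity used for the energy method)] -/
theorem exists_forall_pow_four_mul_norm_sq_le {a b : ℝ} (hab : a < b)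
    {g : ℝ → UnitAddTorus d → EuclideanSpace ℝ d} (hg : IsSmoothSpaceTimeOn (Icc a b) g) :
    ∃ W : ℝ, 0 ≤ W ∧ ∀ τ ∈ Icc a b, ∀ k : d → ℤ,
      freqNormSq k ^ 4 * ‖mFourierCoeff (EuclideanSpace.complexify ∘ g τ) k‖ ^ 2 ≤ W := by
  have hL : IsSmoothSpaceTimeOn (Icc a b) (fun τ => Torus.laplacian (g τ)) :=
    hg.laplacian (uniqueDiffOn_Icc hab)
  obtain ⟨D, hD0, hD⟩ := hL.exists_forall_integral_norm_laplacian_sq_le hab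
  refine ⟨D / (4 * Real.pi ^ 2) ^ 4, by positivity, fun τ hτ k => ?_⟩
  have hgt : IsSmooth (g τ) := hg.isSmooth_slice hτ
  have hsum := hasSum_freqNormSq_sq_mul_norm_sq_mFourierCoeff hgt.laplacian
  have hle : (4 * Real.pi ^ 2 * freqNormSq k) ^ 2 *
      ‖mFourierCoeff (EuclideanSpace.complexify ∘ Torus.laplacian (g τ)) k‖ ^ 2 ≤ D :=
    (le_hasSum hsum k fun j _ => mul_nonneg (sq_nonneg _) (sq_nonneg _)).trans (hD τ hτ)
  rw [mFourierCoeff_complexify_laplacian hgt, norm_neg, norm_smul, Complex.norm_real,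
    Real.norm_eq_abs, abs_of_nonneg (by have := freqNormSq_nonneg k; positivity)] at hle
  rw [le_div_iff₀ (by positivity)]
  calc freqNormSq k ^ 4 * ‖mFourierCoeff (EuclideanSpace.complexify ∘ g τ) k‖ ^ 2 *
        (4 * Real.pi ^ 2) ^ 4
      = (4 * Real.pi ^ 2 * freqNormSq k) ^ 2 * (4 * Real.pi ^ 2 * freqNormSq k *
          ‖mFourierCoeff (EuclideanSpace.complexify ∘ g τ) k‖) ^ 2 := by ring
    _ ≤ D := hle

/-! ### §2 The full Sobolev sum is differentiable in time, termwise -/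

/-- **Termwise differentiation of the `Ḣ^s` sum** (the regularity behind "taking the inner
product of the equation with `u` in `Ḣ^s`", Robinson–Sadowski–Silva §IV): for `u` jointly smooth
on `[a, b] × T^n`, `s > 0` and `n < 8 − 2s`, at every interior time `t` the function
`τ ↦ ∑_k |k|^{2s} ‖û(τ,k)‖²` has derivative `∑_k |k|^{2s} · 2 Re⟪𝓕(∂ₜu(t))(k), û(t,k)⟫_ℂ`
(`∂ₜ = timeDerivWithin [a,b]`; `hasDerivAt_tsum_of_isPreconnected` with the majorant
`|k|^{2s}(‖𝓕(∂ₜu)(k)‖² + ‖û(k)‖²) ≤ W |k|^{2s−8}` of §1).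
[cite: RobinsonSadowskiSilva2012, §IV (energy method in `Ḣ^s`)] -/
theorem hasDerivAt_tsum_rpow_mul_norm_sq {a b : ℝ} (hab : a < b)
    {u : ℝ → UnitAddTorus d → EuclideanSpace ℝ d} (hu : IsSmoothSpaceTimeOn (Icc a b) u)
    {s : ℝ} (hs : 0 < s) (hsd : (Fintype.card d : ℝ) < 2 * (4 - s)) {t : ℝ} (ht : t ∈ Ioo a b) :
    HasDerivAt (fun τ => ∑' k : d → ℤ,
        freqNormSq k ^ s * ‖mFourierCoeff (EuclideanSpace.complexify ∘ u τ) k‖ ^ 2)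
      (∑' k : d → ℤ, freqNormSq k ^ s *
        (2 * (inner ℂ (mFourierCoeff (EuclideanSpace.complexify ∘ timeDerivWithin (Icc a b) u t) k)
          (mFourierCoeff (EuclideanSpace.complexify ∘ u t) k)).re)) t := by
  classical
  have hU : UniqueDiffOn ℝ (Icc a b) := uniqueDiffOn_Icc hab
  have hw : IsSmoothSpaceTimeOn (Icc a b) (timeDerivWithin (Icc a b) u) := hu.timeDerivWithin hU
  obtain ⟨W₁, hW₁0, hW₁⟩ := exists_forall_pow_four_mul_norm_sq_le hab hu
  obtain ⟨W₂, hW₂0, hW₂⟩ := exists_forall_pow_four_mul_norm_sq_le hab hw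
  set M : (d → ℤ) → ℝ := fun k =>
    (W₁ + W₂) * (if k = 0 then (0 : ℝ) else freqNormSq k ^ (-(4 - s))) with hM
  have hMs : Summable M := (summable_ite_freqNormSq_rpow_neg (d := d) (by linarith)).mul_left _
  have hderiv : ∀ (k : d → ℤ) (τ : ℝ), τ ∈ Ioo a b →
      HasDerivAt (fun τ => freqNormSq k ^ s * ‖mFourierCoeff (EuclideanSpace.complexify ∘ u τ) k‖ ^ 2)
        (freqNormSq k ^ s * (2 * (inner ℂ
          (mFourierCoeff (EuclideanSpace.complexify ∘ timeDerivWithin (Icc a b) u τ) k)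
          (mFourierCoeff (EuclideanSpace.complexify ∘ u τ) k)).re)) τ := fun k τ hτ =>
    ((hasDerivWithinAt_norm_sq_mFourierCoeff hu (convex_Icc a b) hU
      (Ioo_subset_Icc_self hτ) k).hasDerivAt (Icc_mem_nhds hτ.1 hτ.2)).const_mul _
  have hbound : ∀ (k : d → ℤ) (τ : ℝ), τ ∈ Ioo a b →
      ‖freqNormSq k ^ s * (2 * (inner ℂ
          (mFourierCoeff (EuclideanSpace.complexify ∘ timeDerivWithin (Icc a b) u τ) k)
          (mFourierCoeff (EuclideanSpace.complexify ∘ u τ) k)).re)‖ ≤ M k := by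
    intro k τ hτ
    have hτ' : τ ∈ Icc a b := Ioo_subset_Icc_self hτ
    set α : EuclideanSpace ℂ d :=
      mFourierCoeff (EuclideanSpace.complexify ∘ timeDerivWithin (Icc a b) u τ) k with hα
    set β : EuclideanSpace ℂ d := mFourierCoeff (EuclideanSpace.complexify ∘ u τ) k with hβ
    rw [Real.norm_eq_abs, abs_mul, abs_of_nonneg (Real.rpow_nonneg (freqNormSq_nonneg k) s)]
    have h1 : |2 * (inner ℂ α β).re| ≤ ‖α‖ ^ 2 + ‖β‖ ^ 2 := by
      rw [abs_mul, abs_two]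
      have := (Complex.abs_re_le_norm (inner ℂ α β)).trans (norm_inner_le_norm α β)
      nlinarith [sq_nonneg (‖α‖ - ‖β‖), norm_nonneg α, norm_nonneg β,
        abs_nonneg (inner ℂ α β).re]
    by_cases hk : k = 0
    · have hx : freqNormSq k = 0 := by rw [hk, freqNormSq_zero]
      have hM0 : M k = 0 := by simp only [hM, if_pos hk, mul_zero]
      rw [hx, Real.zero_rpow hs.ne', zero_mul, hM0]
    · have hx : 1 ≤ freqNormSq k := one_le_freqNormSq_of_ne_zero hk
      have hx0 : 0 < freqNormSq k := by linarith
      have e : freqNormSq k ^ s = freqNormSq k ^ (-(4 - s)) * freqNormSq k ^ 4 := by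
        rw [← Real.rpow_natCast (freqNormSq k) 4, ← Real.rpow_add hx0]
        congr 1
        push_cast
        ring
      have hMk : M k = freqNormSq k ^ (-(4 - s)) * (W₂ + W₁) := by
        simp only [hM, if_neg hk]
        ring
      calc freqNormSq k ^ s * |2 * (inner ℂ α β).re|
          ≤ freqNormSq k ^ s * (‖α‖ ^ 2 + ‖β‖ ^ 2) :=
            mul_le_mul_of_nonneg_left h1 (Real.rpow_nonneg (freqNormSq_nonneg k) s)
        _ = freqNormSq k ^ (-(4 - s)) *
              (freqNormSq k ^ 4 * ‖α‖ ^ 2 + freqNormSq k ^ 4 * ‖β‖ ^ 2) := by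
            rw [e]; ring
        _ ≤ freqNormSq k ^ (-(4 - s)) * (W₂ + W₁) :=
            mul_le_mul_of_nonneg_left (add_le_add (hW₂ τ hτ' k) (hW₁ τ hτ' k))
              (Real.rpow_nonneg (freqNormSq_nonneg k) _)
        _ = M k := hMk.symm
  have hsum0 : Summable fun k : d → ℤ =>
      freqNormSq k ^ s * ‖mFourierCoeff (EuclideanSpace.complexify ∘ u t) k‖ ^ 2 :=
    (hu.isSmooth_slice (Ioo_subset_Icc_self ht)).summable_freqNormSq_rpow_mul_norm_sq hs.le
  exact hasDerivAt_tsum_of_isPreconnected hMs isOpen_Ioo isPreconnected_Ioo hderiv hbound ht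
    hsum0 ht

/-! ### §3 The `Ḣ^s` energy inequality along a classical solution -/

omit [DecidableEq d] in
/-- The zero force has zero Fourier coefficients. [folklore] -/
private theorem mFourierCoeff_complexify_zero_force (t : ℝ) (k : d → ℤ) :
    mFourierCoeff (EuclideanSpace.complexify ∘
      (0 : ℝ → UnitAddTorus d → EuclideanSpace ℝ d) t) k = 0 := by
  have h : (EuclideanSpace.complexify ∘ (0 : ℝ → UnitAddTorus d → EuclideanSpace ℝ d) t) =
      (0 : UnitAddTorus d → EuclideanSpace ℂ d) := by
    funext x
    simp
  rw [h, mFourierCoeff_eq_integral_volume]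
  simp

/-- **The `Ḣ^s` energy inequality** (Robinson–Sadowski–Silva 2012, §IV, first display:
"`½ d/dt‖u‖_s² + ‖u‖²_{s+1} ≤ c_s ‖u‖_s‖u‖_{s+1}‖u‖_F ≤ c_s ‖u‖_s^{s+1/2}‖u‖_{s+1}^{5/2−s}`",
`1/2 < s < 3/2`, using (3.5) and (3.10)), for classical solutions on `T³`: for `card d = 3` and
`1/2 < s < 3/2` there is `K = K(s) ≥ 0` such that for every `ν > 0`, every classical solution
`(u, p)` of `Torus.IsClassicalNSSolutionOn (Icc a b) ν 0 u p` (zero force) with mean-zero slices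
and every interior time `t ∈ (a, b)`, the `Ḣ^s` sum `X(τ) = ∑_k |k|^{2s}‖û(τ,k)‖²` is
differentiable at `t` with
`X'(t) ≤ −8π²ν Z(t) + K X(t)^{(2s+1)/4} Z(t)^{(5−2s)/4}`, `Z = ∑_k |k|^{2s+2}‖û(k)‖²`
(written with `√X^{s+1/2} √Z^{5/2−s}`; `|k|² = freqNormSq k`, so `ν‖Λ^{s+1}u‖²` reads `8π²ν Z/2`).
[cite: RobinsonSadowskiSilva2012, §IV (display before (4.2), case 1/2 < s < 3/2)] -/
theorem hsSeminorm_sq_deriv_le (hd : Fintype.card d = 3) {s : ℝ} (hs : 1 / 2 < s) (hs' : s < 3 / 2) :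
    ∃ K : ℝ, 0 ≤ K ∧ ∀ {ν a b : ℝ}, 0 < ν → a < b →
      ∀ {u : ℝ → UnitAddTorus d → EuclideanSpace ℝ d} {p : ℝ → UnitAddTorus d → ℝ},
      IsClassicalNSSolutionOn (Icc a b) ν 0 u p → (∀ t ∈ Icc a b, HasZeroMean (u t)) →
      ∀ t ∈ Ioo a b, ∃ D : ℝ,
        HasDerivAt (fun τ => ∑' k : d → ℤ,
          freqNormSq k ^ s * ‖mFourierCoeff (EuclideanSpace.complexify ∘ u τ) k‖ ^ 2) D t ∧
        D ≤ -(8 * Real.pi ^ 2 * ν) *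
              (∑' k : d → ℤ, freqNormSq k ^ (s + 1) *
                ‖mFourierCoeff (EuclideanSpace.complexify ∘ u t) k‖ ^ 2) +
            K * Real.sqrt (∑' k : d → ℤ, freqNormSq k ^ s *
                  ‖mFourierCoeff (EuclideanSpace.complexify ∘ u t) k‖ ^ 2) ^ (s + 1 / 2) *
              Real.sqrt (∑' k : d → ℤ, freqNormSq k ^ (s + 1) *
                  ‖mFourierCoeff (EuclideanSpace.complexify ∘ u t) k‖ ^ 2) ^ (5 / 2 - s) := by
  classical
  have hn : (Fintype.card d : ℝ) = 3 := by rw [hd]; norm_num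
  obtain ⟨CI, hCI0, hCI⟩ := exists_tsum_rpow_mul_norm_le_interpolation (d := d) (r := 0) (s₁ := s)
    (s₂ := s + 1) (by rw [hn]; linarith) (by rw [hn]; linarith)
  set CT : ℝ := 4 * Real.pi * (Fintype.card d : ℝ) ^ 2 * (2 : ℝ) ^ s with hCT
  have hCT0 : 0 ≤ CT := by rw [hCT]; positivity
  refine ⟨2 * CT * CI, by positivity, fun {ν a b} hν hab {u p} h hmean t ht => ?_⟩
  have hU : UniqueDiffOn ℝ (Icc a b) := uniqueDiffOn_Icc hab
  have htS : t ∈ Icc a b := Ioo_subset_Icc_self ht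
  have hut : IsSmooth (u t) := h.smooth_velocity.isSmooth_slice htS
  refine ⟨_, hasDerivAt_tsum_rpow_mul_norm_sq hab h.smooth_velocity (by linarith)
    (by rw [hn]; linarith) ht, ?_⟩
  -- notation
  set c : (d → ℤ) → EuclideanSpace ℂ d := fun k => mFourierCoeff (EuclideanSpace.complexify ∘ u t) k
    with hc
  set w : (d → ℤ) → EuclideanSpace ℂ d :=
    fun k => mFourierCoeff (EuclideanSpace.complexify ∘ timeDerivWithin (Icc a b) u t) k with hw
  set B : (d → ℤ) → EuclideanSpace ℂ d :=
    fun k => mFourierCoeff (EuclideanSpace.complexify ∘ Torus.convect (u t) (u t)) k with hB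
  set X : ℝ := ∑' k, freqNormSq k ^ s * ‖c k‖ ^ 2 with hX
  set Z : ℝ := ∑' k, freqNormSq k ^ (s + 1) * ‖c k‖ ^ 2 with hZ
  set F : ℝ := ∑' k, ‖c k‖ with hF
  have hw0 : ∀ (r : ℝ) k, 0 ≤ freqNormSq k ^ r * ‖c k‖ ^ 2 := fun r k =>
    mul_nonneg (Real.rpow_nonneg (freqNormSq_nonneg k) _) (sq_nonneg _)
  have hsumX : Summable fun k => freqNormSq k ^ s * ‖c k‖ ^ 2 :=
    hut.summable_freqNormSq_rpow_mul_norm_sq (by linarith)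
  have hsumZ : Summable fun k => freqNormSq k ^ (s + 1) * ‖c k‖ ^ 2 :=
    hut.summable_freqNormSq_rpow_mul_norm_sq (by linarith)
  have hX0 : 0 ≤ X := tsum_nonneg (hw0 s)
  have hZ0 : 0 ≤ Z := tsum_nonneg (hw0 (s + 1))
  have hF0 : 0 ≤ F := tsum_nonneg fun k => norm_nonneg _
  show ∑' k, freqNormSq k ^ s * (2 * (inner ℂ (w k) (c k)).re) ≤
    -(8 * Real.pi ^ 2 * ν) * Z + 2 * CT * CI * Real.sqrt X ^ (s + 1 / 2) * Real.sqrt Z ^ (5 / 2 - s)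
  -- ### the modewise energy identity (pressure invisible, zero force)
  have hid : ∀ k, (inner ℂ (w k) (c k)).re =
      -(ν * (4 * Real.pi ^ 2 * freqNormSq k)) * ‖c k‖ ^ 2 - (inner ℂ (B k) (c k)).re := by
    intro k
    have h1 := h.re_inner_mFourierCoeff_timeDerivWithin hU htS k
    rw [mFourierCoeff_complexify_zero_force, inner_zero_left, Complex.zero_re, add_zero] at h1
    exact h1
  -- ### the trilinear family is summable and bounded by (3.5)
  set Rk : (d → ℤ) → ℝ := fun k => freqNormSq k ^ s * ‖c k‖ * ‖B k‖ with hR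
  have hR0 : ∀ k, 0 ≤ Rk k := fun k =>
    mul_nonneg (mul_nonneg (Real.rpow_nonneg (freqNormSq_nonneg k) _) (norm_nonneg _)) (norm_nonneg _)
  have hRK : ∀ K : Finset (d → ℤ), ∑ k ∈ K, Rk k ≤ CT * F * Real.sqrt X * Real.sqrt Z := by
    intro K
    have h1 := sum_rpow_mul_norm_mul_norm_convect_le hut (h.divFree t htS) (by linarith : 0 ≤ s) K
    refine h1.trans ?_
    have h2 : Real.sqrt (∑ k ∈ K, freqNormSq k ^ (s + 1) * ‖c k‖ ^ 2) ≤ Real.sqrt Z :=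
      Real.sqrt_le_sqrt (sum_le_hasSum K (fun k _ => hw0 (s + 1) k) hsumZ.hasSum)
    exact mul_le_mul_of_nonneg_left h2 (mul_nonneg (mul_nonneg hCT0 hF0) (Real.sqrt_nonneg _))
  have hRs : Summable Rk := summable_of_sum_le hR0 hRK
  have hRle : ∑' k, Rk k ≤ CT * F * Real.sqrt X * Real.sqrt Z := Real.tsum_le_of_sum_le hR0 hRK
  -- ### `‖u‖_F ≤ C_I ‖u‖_s^{s−1/2} ‖u‖_{s+1}^{3/2−s}` (Lemma 3.2 at `r = 0`)
  have hFle : F ≤ CI * Real.sqrt X ^ (s - 1 / 2) * Real.sqrt Z ^ (3 / 2 - s) := by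
    obtain ⟨-, hle⟩ := hCI (u t) (hut.memLp 2) (hmean t htS) hsumZ
    have e1 : (s + 1 - 0 - (Fintype.card d : ℝ) / 2) / (s + 1 - s) = s - 1 / 2 := by
      rw [hn]; ring
    have e2 : ((Fintype.card d : ℝ) / 2 + 0 - s) / (s + 1 - s) = 3 / 2 - s := by
      rw [hn]; ring
    rw [e1, e2] at hle
    simpa only [zero_div, Real.rpow_zero, one_mul] using hle
  -- ### split the derivative: `D = −8π²ν Z − 2 ∑ |k|^{2s} Re⟪B̂(k), û(k)⟫`
  set Qk : (d → ℤ) → ℝ := fun k => freqNormSq k ^ s * (inner ℂ (B k) (c k)).re with hQ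
  have hQle : ∀ k, |Qk k| ≤ Rk k := fun k => by
    simp only [hQ, hR, abs_mul, abs_of_nonneg (Real.rpow_nonneg (freqNormSq_nonneg k) s), mul_assoc]
    exact mul_le_mul_of_nonneg_left
      ((Complex.abs_re_le_norm _).trans ((norm_inner_le_norm (B k) (c k)).trans
        (le_of_eq (mul_comm _ _))))
      (Real.rpow_nonneg (freqNormSq_nonneg k) s)
  have hQs : Summable Qk := Summable.of_norm_bounded hRs fun k => (Real.norm_eq_abs _).le.trans (hQle k)
  have hterm : ∀ k, freqNormSq k ^ s * (2 * (inner ℂ (w k) (c k)).re) =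
      -(8 * Real.pi ^ 2 * ν) * (freqNormSq k ^ (s + 1) * ‖c k‖ ^ 2) - 2 * Qk k := by
    intro k
    rw [hid k]
    simp only [hQ]
    have e : freqNormSq k ^ (s + 1) = freqNormSq k ^ s * freqNormSq k := by
      rw [Real.rpow_add' (freqNormSq_nonneg k) (by linarith : s + 1 ≠ 0), Real.rpow_one]
    rw [e]
    ring
  have hD : ∑' k, freqNormSq k ^ s * (2 * (inner ℂ (w k) (c k)).re) =
      -(8 * Real.pi ^ 2 * ν) * Z - 2 * ∑' k, Qk k := by
    rw [tsum_congr hterm, (hsumZ.mul_left _).tsum_sub (hQs.mul_left 2), tsum_mul_left,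
      tsum_mul_left]
  rw [hD]
  -- ### `−2 ∑ Qk ≤ 2 ∑ Rk ≤ 2 C_T ‖u‖_F ‖u‖_s ‖u‖_{s+1} ≤ 2 C_T C_I ‖u‖_s^{s+1/2} ‖u‖_{s+1}^{5/2−s}`
  have hQR : -(∑' k, Qk k) ≤ ∑' k, Rk k := by
    rw [← tsum_neg]
    exact Summable.tsum_le_tsum (fun k => (neg_le_abs (Qk k)).trans (hQle k)) hQs.neg hRs
  have hprod : F * Real.sqrt X * Real.sqrt Z ≤
      CI * Real.sqrt X ^ (s + 1 / 2) * Real.sqrt Z ^ (5 / 2 - s) := by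
    have hx0 : 0 ≤ Real.sqrt X := Real.sqrt_nonneg _
    have hz0 : 0 ≤ Real.sqrt Z := Real.sqrt_nonneg _
    have e1 : Real.sqrt X ^ (s + 1 / 2) = Real.sqrt X ^ (s - 1 / 2) * Real.sqrt X := by
      rw [show s + 1 / 2 = (s - 1 / 2) + 1 by ring,
        Real.rpow_add' hx0 (by linarith : (0 : ℝ) < s - 1 / 2 + 1).ne', Real.rpow_one]
    have e2 : Real.sqrt Z ^ (5 / 2 - s) = Real.sqrt Z ^ (3 / 2 - s) * Real.sqrt Z := by
      rw [show 5 / 2 - s = (3 / 2 - s) + 1 by ring,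
        Real.rpow_add' hz0 (by linarith : (0 : ℝ) < 3 / 2 - s + 1).ne', Real.rpow_one]
    rw [e1, e2]
    calc F * Real.sqrt X * Real.sqrt Z
        ≤ CI * Real.sqrt X ^ (s - 1 / 2) * Real.sqrt Z ^ (3 / 2 - s) * Real.sqrt X * Real.sqrt Z :=
          mul_le_mul_of_nonneg_right (mul_le_mul_of_nonneg_right hFle hx0) hz0
      _ = CI * (Real.sqrt X ^ (s - 1 / 2) * Real.sqrt X) *
            (Real.sqrt Z ^ (3 / 2 - s) * Real.sqrt Z) := by ring
  have hfin : -(2 : ℝ) * ∑' k, Qk k ≤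
      2 * CT * CI * Real.sqrt X ^ (s + 1 / 2) * Real.sqrt Z ^ (5 / 2 - s) := by
    calc -(2 : ℝ) * ∑' k, Qk k = 2 * -(∑' k, Qk k) := by ring
      _ ≤ 2 * ∑' k, Rk k := by linarith [hQR]
      _ ≤ 2 * (CT * F * Real.sqrt X * Real.sqrt Z) := by linarith [hRle]
      _ = 2 * CT * (F * Real.sqrt X * Real.sqrt Z) := by ring
      _ ≤ 2 * CT * (CI * Real.sqrt X ^ (s + 1 / 2) * Real.sqrt Z ^ (5 / 2 - s)) :=
          mul_le_mul_of_nonneg_left hprod (by positivity)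
      _ = 2 * CT * CI * Real.sqrt X ^ (s + 1 / 2) * Real.sqrt Z ^ (5 / 2 - s) := by ring
  linarith [hfin]

/-- **The `Ḣ^s` energy inequality for `3/2 < s < 5/2`** (Robinson–Sadowski–Silva 2012, §IV:
"We obtain the same differential inequality when `3/2 < s < 5/2`, since
`½ d/dt‖u‖_s² + ‖u‖²_{s+1} ≤ c_s‖u‖_s²‖u‖_{F_1} ≤ c_s‖u‖_s²‖u‖_s^{s−3/2}‖u‖_{s+1}^{5/2−s}
= c_s‖u‖_s^{s+1/2}‖u‖_{s+1}^{5/2−s}`, now using (3.6) and (3.10) once more"), classical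
solutions on `T³`, `ν` explicit: for `card d = 3` and `3/2 < s < 5/2` there is `K = K(s) ≥ 0` with
`X'(t) ≤ −8π²ν ∑|k|^{2s+2}‖û‖² + K (∑|k|^{2s}‖û‖²)^{(2s+1)/4} (∑|k|^{2s+2}‖û‖²)^{(5−2s)/4}`
along every classical mean-zero solution — the same shape as `NSSobolev.hsSeminorm_sq_deriv_le`
(there `1/2 < s < 3/2` via (3.5)); here via the commutator estimate
`NSSobolev.abs_tsum_rpow_mul_re_inner_convect_le` ((3.6)) and Lemma 3.2 at `r = 1`
(`Torus.exists_tsum_rpow_mul_norm_le_interpolation`, `s < 5/2 < s + 1`).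
[cite: RobinsonSadowskiSilva2012, §IV (the case 3/2 < s < 5/2)] -/
theorem hsSeminorm_sq_deriv_le_of_gt (hd : Fintype.card d = 3) {s : ℝ} (hs : 3 / 2 < s)
    (hs' : s < 5 / 2) :
    ∃ K : ℝ, 0 ≤ K ∧ ∀ {ν a b : ℝ}, 0 < ν → a < b →
      ∀ {u : ℝ → UnitAddTorus d → EuclideanSpace ℝ d} {p : ℝ → UnitAddTorus d → ℝ},
      IsClassicalNSSolutionOn (Icc a b) ν 0 u p → (∀ t ∈ Icc a b, HasZeroMean (u t)) →
      ∀ t ∈ Ioo a b, ∃ D : ℝ,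
        HasDerivAt (fun τ => ∑' k : d → ℤ,
          freqNormSq k ^ s * ‖mFourierCoeff (EuclideanSpace.complexify ∘ u τ) k‖ ^ 2) D t ∧
        D ≤ -(8 * Real.pi ^ 2 * ν) *
              (∑' k : d → ℤ, freqNormSq k ^ (s + 1) *
                ‖mFourierCoeff (EuclideanSpace.complexify ∘ u t) k‖ ^ 2) +
            K * Real.sqrt (∑' k : d → ℤ, freqNormSq k ^ s *
                  ‖mFourierCoeff (EuclideanSpace.complexify ∘ u t) k‖ ^ 2) ^ (s + 1 / 2) *
              Real.sqrt (∑' k : d → ℤ, freqNormSq k ^ (s + 1) *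
                  ‖mFourierCoeff (EuclideanSpace.complexify ∘ u t) k‖ ^ 2) ^ (5 / 2 - s) := by
  classical
  have hn : (Fintype.card d : ℝ) = 3 := by rw [hd]; norm_num
  obtain ⟨CI, hCI0, hCI⟩ := exists_tsum_rpow_mul_norm_le_interpolation (d := d) (r := 1) (s₁ := s)
    (s₂ := s + 1) (by rw [hn]; linarith) (by rw [hn]; linarith)
  set CT : ℝ := 4 * Real.pi * (Fintype.card d : ℝ) ^ 2 * (2 : ℝ) ^ s with hCT
  have hCT0 : 0 ≤ CT := by rw [hCT]; positivity
  set C₆ : ℝ := 4 * Real.pi * (Fintype.card d : ℝ) * (s * (2 : ℝ) ^ s) with hC₆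
  have hs0 : (0 : ℝ) ≤ s := by linarith
  have hC₆0 : 0 ≤ C₆ := by rw [hC₆]; positivity
  refine ⟨2 * C₆ * CI, by positivity, fun {ν a b} hν hab {u p} h hmean t ht => ?_⟩
  have hU : UniqueDiffOn ℝ (Icc a b) := uniqueDiffOn_Icc hab
  have htS : t ∈ Icc a b := Ioo_subset_Icc_self ht
  have hut : IsSmooth (u t) := h.smooth_velocity.isSmooth_slice htS
  refine ⟨_, hasDerivAt_tsum_rpow_mul_norm_sq hab h.smooth_velocity (by linarith)
    (by rw [hn]; linarith) ht, ?_⟩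
  -- notation
  set c : (d → ℤ) → EuclideanSpace ℂ d := fun k => mFourierCoeff (EuclideanSpace.complexify ∘ u t) k
    with hc
  set w : (d → ℤ) → EuclideanSpace ℂ d :=
    fun k => mFourierCoeff (EuclideanSpace.complexify ∘ timeDerivWithin (Icc a b) u t) k with hw
  set B : (d → ℤ) → EuclideanSpace ℂ d :=
    fun k => mFourierCoeff (EuclideanSpace.complexify ∘ Torus.convect (u t) (u t)) k with hB
  set X : ℝ := ∑' k, freqNormSq k ^ s * ‖c k‖ ^ 2 with hX
  set Z : ℝ := ∑' k, freqNormSq k ^ (s + 1) * ‖c k‖ ^ 2 with hZ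
  set F : ℝ := ∑' k, ‖c k‖ with hF
  set F₁ : ℝ := ∑' k, Real.sqrt (freqNormSq k) * ‖c k‖ with hF₁
  have hw0 : ∀ (r : ℝ) k, 0 ≤ freqNormSq k ^ r * ‖c k‖ ^ 2 := fun r k =>
    mul_nonneg (Real.rpow_nonneg (freqNormSq_nonneg k) _) (sq_nonneg _)
  have hsumX : Summable fun k => freqNormSq k ^ s * ‖c k‖ ^ 2 :=
    hut.summable_freqNormSq_rpow_mul_norm_sq (by linarith)
  have hsumZ : Summable fun k => freqNormSq k ^ (s + 1) * ‖c k‖ ^ 2 :=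
    hut.summable_freqNormSq_rpow_mul_norm_sq (by linarith)
  have hX0 : 0 ≤ X := tsum_nonneg (hw0 s)
  have hZ0 : 0 ≤ Z := tsum_nonneg (hw0 (s + 1))
  have hF0 : 0 ≤ F := tsum_nonneg fun k => norm_nonneg _
  show ∑' k, freqNormSq k ^ s * (2 * (inner ℂ (w k) (c k)).re) ≤
    -(8 * Real.pi ^ 2 * ν) * Z + 2 * C₆ * CI * Real.sqrt X ^ (s + 1 / 2) * Real.sqrt Z ^ (5 / 2 - s)
  -- ### the modewise energy identity (pressure invisible, zero force)
  have hid : ∀ k, (inner ℂ (w k) (c k)).re =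
      -(ν * (4 * Real.pi ^ 2 * freqNormSq k)) * ‖c k‖ ^ 2 - (inner ℂ (B k) (c k)).re := by
    intro k
    have h1 := h.re_inner_mFourierCoeff_timeDerivWithin hU htS k
    rw [mFourierCoeff_complexify_zero_force, inner_zero_left, Complex.zero_re, add_zero] at h1
    exact h1
  -- ### the trilinear family is summable ((3.5) gives absolute summability for every `s ≥ 0`)
  set Rk : (d → ℤ) → ℝ := fun k => freqNormSq k ^ s * ‖c k‖ * ‖B k‖ with hR
  have hR0 : ∀ k, 0 ≤ Rk k := fun k =>
    mul_nonneg (mul_nonneg (Real.rpow_nonneg (freqNormSq_nonneg k) _) (norm_nonneg _)) (norm_nonneg _)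
  have hRK : ∀ K : Finset (d → ℤ), ∑ k ∈ K, Rk k ≤ CT * F * Real.sqrt X * Real.sqrt Z := by
    intro K
    have h1 := sum_rpow_mul_norm_mul_norm_convect_le hut (h.divFree t htS) hs0 K
    refine h1.trans ?_
    have h2 : Real.sqrt (∑ k ∈ K, freqNormSq k ^ (s + 1) * ‖c k‖ ^ 2) ≤ Real.sqrt Z :=
      Real.sqrt_le_sqrt (sum_le_hasSum K (fun k _ => hw0 (s + 1) k) hsumZ.hasSum)
    exact mul_le_mul_of_nonneg_left h2 (mul_nonneg (mul_nonneg hCT0 hF0) (Real.sqrt_nonneg _))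
  have hRs : Summable Rk := summable_of_sum_le hR0 hRK
  -- ### `‖u‖_{F_1} ≤ C_I ‖u‖_s^{s−3/2} ‖u‖_{s+1}^{5/2−s}` (Lemma 3.2 at `r = 1`)
  have hF₁le : F₁ ≤ CI * Real.sqrt X ^ (s - 3 / 2) * Real.sqrt Z ^ (5 / 2 - s) := by
    obtain ⟨-, hle⟩ := hCI (u t) (hut.memLp 2) (hmean t htS) hsumZ
    have e1 : (s + 1 - 1 - (Fintype.card d : ℝ) / 2) / (s + 1 - s) = s - 3 / 2 := by
      rw [hn]; ring
    have e2 : ((Fintype.card d : ℝ) / 2 + 1 - s) / (s + 1 - s) = 5 / 2 - s := by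
      rw [hn]; ring
    rw [e1, e2] at hle
    have e3 : ∑' k, freqNormSq k ^ ((1 : ℝ) / 2) * ‖c k‖ = F₁ :=
      tsum_congr fun k => by rw [← Real.sqrt_eq_rpow]
    rw [e3] at hle
    exact hle
  -- ### split the derivative: `D = −8π²ν Z − 2 ∑ |k|^{2s} Re⟪B̂(k), û(k)⟫`
  set Qk : (d → ℤ) → ℝ := fun k => freqNormSq k ^ s * (inner ℂ (B k) (c k)).re with hQ
  have hQle : ∀ k, |Qk k| ≤ Rk k := fun k => by
    simp only [hQ, hR, abs_mul, abs_of_nonneg (Real.rpow_nonneg (freqNormSq_nonneg k) s), mul_assoc]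
    exact mul_le_mul_of_nonneg_left
      ((Complex.abs_re_le_norm _).trans ((norm_inner_le_norm (B k) (c k)).trans
        (le_of_eq (mul_comm _ _))))
      (Real.rpow_nonneg (freqNormSq_nonneg k) s)
  have hQs : Summable Qk := Summable.of_norm_bounded hRs fun k => (Real.norm_eq_abs _).le.trans (hQle k)
  have hterm : ∀ k, freqNormSq k ^ s * (2 * (inner ℂ (w k) (c k)).re) =
      -(8 * Real.pi ^ 2 * ν) * (freqNormSq k ^ (s + 1) * ‖c k‖ ^ 2) - 2 * Qk k := by
    intro k
    rw [hid k]
    simp only [hQ]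
    have e : freqNormSq k ^ (s + 1) = freqNormSq k ^ s * freqNormSq k := by
      rw [Real.rpow_add' (freqNormSq_nonneg k) (by linarith : s + 1 ≠ 0), Real.rpow_one]
    rw [e]
    ring
  have hD : ∑' k, freqNormSq k ^ s * (2 * (inner ℂ (w k) (c k)).re) =
      -(8 * Real.pi ^ 2 * ν) * Z - 2 * ∑' k, Qk k := by
    rw [tsum_congr hterm, (hsumZ.mul_left _).tsum_sub (hQs.mul_left 2), tsum_mul_left,
      tsum_mul_left]
  rw [hD]
  -- ### (3.6): `|∑ Qk| ≤ C₆ X F₁ ≤ C₆ C_I X ‖u‖_s^{s−3/2} ‖u‖_{s+1}^{5/2−s}`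
  have h36 : |∑' k, Qk k| ≤ C₆ * X * F₁ :=
    abs_tsum_rpow_mul_re_inner_convect_le hut (h.divFree t htS) (by linarith : (1 : ℝ) ≤ s)
  have hprod : X * F₁ ≤ CI * Real.sqrt X ^ (s + 1 / 2) * Real.sqrt Z ^ (5 / 2 - s) := by
    have hx0 : 0 ≤ Real.sqrt X := Real.sqrt_nonneg _
    have e1 : Real.sqrt X ^ (s + 1 / 2) = X * Real.sqrt X ^ (s - 3 / 2) := by
      rw [show s + 1 / 2 = 2 + (s - 3 / 2) by ring,
        Real.rpow_add' hx0 (by linarith : (0 : ℝ) < 2 + (s - 3 / 2)).ne',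
        show (2 : ℝ) = ((2 : ℕ) : ℝ) by norm_num, Real.rpow_natCast, Real.sq_sqrt hX0]
    rw [e1]
    calc X * F₁ ≤ X * (CI * Real.sqrt X ^ (s - 3 / 2) * Real.sqrt Z ^ (5 / 2 - s)) :=
          mul_le_mul_of_nonneg_left hF₁le hX0
      _ = CI * (X * Real.sqrt X ^ (s - 3 / 2)) * Real.sqrt Z ^ (5 / 2 - s) := by ring
  have hfin : -(2 : ℝ) * ∑' k, Qk k ≤
      2 * C₆ * CI * Real.sqrt X ^ (s + 1 / 2) * Real.sqrt Z ^ (5 / 2 - s) := by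
    calc -(2 : ℝ) * ∑' k, Qk k ≤ 2 * |∑' k, Qk k| := by linarith [neg_abs_le (∑' k, Qk k)]
      _ ≤ 2 * (C₆ * X * F₁) := by linarith [h36]
      _ = 2 * C₆ * (X * F₁) := by ring
      _ ≤ 2 * C₆ * (CI * Real.sqrt X ^ (s + 1 / 2) * Real.sqrt Z ^ (5 / 2 - s)) :=
          mul_le_mul_of_nonneg_left hprod (by positivity)
      _ = 2 * C₆ * CI * Real.sqrt X ^ (s + 1 / 2) * Real.sqrt Z ^ (5 / 2 - s) := by ring
  linarith [hfin]

/-- **The `Ḣ^s` energy inequality on the whole range `1/2 < s < 5/2`, `s ≠ 3/2`**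
(Robinson–Sadowski–Silva 2012, §IV, both cases): the common shape of
`NSSobolev.hsSeminorm_sq_deriv_le` (`s < 3/2`) and `NSSobolev.hsSeminorm_sq_deriv_le_of_gt`
(`s > 3/2`). [cite: RobinsonSadowskiSilva2012, §IV (1/2 < s < 5/2, s ≠ 3/2)] -/
theorem hsSeminorm_sq_deriv_le' (hd : Fintype.card d = 3) {s : ℝ} (hs : 1 / 2 < s)
    (hs' : s < 5 / 2) (hs3 : s ≠ 3 / 2) :
    ∃ K : ℝ, 0 ≤ K ∧ ∀ {ν a b : ℝ}, 0 < ν → a < b →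
      ∀ {u : ℝ → UnitAddTorus d → EuclideanSpace ℝ d} {p : ℝ → UnitAddTorus d → ℝ},
      IsClassicalNSSolutionOn (Icc a b) ν 0 u p → (∀ t ∈ Icc a b, HasZeroMean (u t)) →
      ∀ t ∈ Ioo a b, ∃ D : ℝ,
        HasDerivAt (fun τ => ∑' k : d → ℤ,
          freqNormSq k ^ s * ‖mFourierCoeff (EuclideanSpace.complexify ∘ u τ) k‖ ^ 2) D t ∧
        D ≤ -(8 * Real.pi ^ 2 * ν) *
              (∑' k : d → ℤ, freqNormSq k ^ (s + 1) *
                ‖mFourierCoeff (EuclideanSpace.complexify ∘ u t) k‖ ^ 2) +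
            K * Real.sqrt (∑' k : d → ℤ, freqNormSq k ^ s *
                  ‖mFourierCoeff (EuclideanSpace.complexify ∘ u t) k‖ ^ 2) ^ (s + 1 / 2) *
              Real.sqrt (∑' k : d → ℤ, freqNormSq k ^ (s + 1) *
                  ‖mFourierCoeff (EuclideanSpace.complexify ∘ u t) k‖ ^ 2) ^ (5 / 2 - s) := by
  rcases lt_or_gt_of_ne hs3 with h | h
  · exact hsSeminorm_sq_deriv_le hd hs h
  · exact hsSeminorm_sq_deriv_le_of_gt hd h hs'

/-! ### §4 Young's inequality: the `Ḣ^s` growth-rate law -/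

/-- **The `Ḣ^s` growth-rate law** (Robinson–Sadowski–Silva 2012, §IV: "Application of Young's
inequality on the right-hand side yields `d/dt ‖u‖_s² ≤ c_s ‖u‖_s^{2(2s+1)/(2s−1)}`, showing that
the local existence time depends only on the norm in `Ḣ^s`"; "We obtain the same differential
inequality when `3/2 < s < 5/2`"), for classical solutions on `T³` with the viscosity explicit:
for `card d = 3` and `1/2 < s < 5/2`, `s ≠ 3/2`, there is
`c = c(s) ≥ 0` such that for every `ν > 0`, every classical solution `(u, p)` of
`Torus.IsClassicalNSSolutionOn (Icc a b) ν 0 u p` with mean-zero slices and every `t ∈ (a, b)`,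
`X(τ) = ∑_k |k|^{2s}‖û(τ,k)‖²` is differentiable at `t` and
`X'(t) ≤ −4π²ν ∑_k |k|^{2s+2}‖û(t,k)‖² + c ν^{−(5−2s)/(2s−1)} X(t)^{(2s+1)/(2s−1)}`
(from `NSSobolev.hsSeminorm_sq_deriv_le'` by the weighted AM–GM inequality with weights
`(5−2s)/4`, `(2s−1)/4`, half of the dissipation being kept). By (4.1)–(4.2) of the paper such a
law forces `‖u(T−t)‖_{Ḣ^s} ≥ c t^{−(2s−1)/4}` at a blow-up time (cf. the tree's
`Torus.hsSeminorm_blowup_rate`, obtained by the Leray–`L^q` route).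
[cite: RobinsonSadowskiSilva2012, §IV (display after "Application of Young's inequality")] -/
theorem hsSeminorm_sq_deriv_le_rpow' (hd : Fintype.card d = 3) {s : ℝ} (hs : 1 / 2 < s)
    (hs' : s < 5 / 2) (hs3 : s ≠ 3 / 2) :
    ∃ c : ℝ, 0 ≤ c ∧ ∀ {ν a b : ℝ}, 0 < ν → a < b →
      ∀ {u : ℝ → UnitAddTorus d → EuclideanSpace ℝ d} {p : ℝ → UnitAddTorus d → ℝ},
      IsClassicalNSSolutionOn (Icc a b) ν 0 u p → (∀ t ∈ Icc a b, HasZeroMean (u t)) →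
      ∀ t ∈ Ioo a b, ∃ D : ℝ,
        HasDerivAt (fun τ => ∑' k : d → ℤ,
          freqNormSq k ^ s * ‖mFourierCoeff (EuclideanSpace.complexify ∘ u τ) k‖ ^ 2) D t ∧
        D ≤ -(4 * Real.pi ^ 2 * ν) *
              (∑' k : d → ℤ, freqNormSq k ^ (s + 1) *
                ‖mFourierCoeff (EuclideanSpace.complexify ∘ u t) k‖ ^ 2) +
            c * ν ^ (-((5 - 2 * s) / (2 * s - 1))) *
              (∑' k : d → ℤ, freqNormSq k ^ s *
                ‖mFourierCoeff (EuclideanSpace.complexify ∘ u t) k‖ ^ 2) ^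
                  ((2 * s + 1) / (2 * s - 1)) := by
  classical
  obtain ⟨K, hK0, hK⟩ := hsSeminorm_sq_deriv_le' hd hs hs' hs3
  set θ : ℝ := (5 - 2 * s) / 4 with hθ
  have hθ0 : 0 < θ := by rw [hθ]; linarith
  have hθ1 : θ < 1 := by rw [hθ]; linarith
  have h1θ : 1 - θ = (2 * s - 1) / 4 := by rw [hθ]; ring
  have h1θ0 : 0 < 1 - θ := by linarith
  have hs1 : (0 : ℝ) < 2 * s - 1 := by linarith
  set c : ℝ := (K * (4 * Real.pi ^ 2) ^ (-θ)) ^ (1 / (1 - θ)) with hc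
  have hc0 : 0 ≤ c := Real.rpow_nonneg (mul_nonneg hK0 (Real.rpow_nonneg (by positivity) _)) _
  refine ⟨c, hc0, fun {ν a b} hν hab {u p} h hmean t ht => ?_⟩
  obtain ⟨D, hD, hle⟩ := hK hν hab h hmean t ht
  refine ⟨D, hD, hle.trans ?_⟩
  set X : ℝ := ∑' k : d → ℤ, freqNormSq k ^ s *
    ‖mFourierCoeff (EuclideanSpace.complexify ∘ u t) k‖ ^ 2 with hX
  set Z : ℝ := ∑' k : d → ℤ, freqNormSq k ^ (s + 1) *
    ‖mFourierCoeff (EuclideanSpace.complexify ∘ u t) k‖ ^ 2 with hZ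
  have hw0 : ∀ (r : ℝ) (k : d → ℤ), 0 ≤ freqNormSq k ^ r *
      ‖mFourierCoeff (EuclideanSpace.complexify ∘ u t) k‖ ^ 2 := fun r k =>
    mul_nonneg (Real.rpow_nonneg (freqNormSq_nonneg k) _) (sq_nonneg _)
  have hX0 : 0 ≤ X := tsum_nonneg (hw0 s)
  have hZ0 : 0 ≤ Z := tsum_nonneg (hw0 (s + 1))
  set L : ℝ := 4 * Real.pi ^ 2 * ν with hL
  have hL0 : 0 < L := by rw [hL]; positivity
  have hLθ : 0 < L ^ θ := Real.rpow_pos_of_pos hL0 θ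
  set β : ℝ := (2 * s + 1) / (2 * s - 1) with hβ
  have hKL0 : 0 ≤ K * L ^ (-θ) := mul_nonneg hK0 (Real.rpow_nonneg hL0.le _)
  set M : ℝ := (K * L ^ (-θ)) ^ (1 / (1 - θ)) * X ^ β with hM
  have hM0 : 0 ≤ M := mul_nonneg (Real.rpow_nonneg hKL0 _) (Real.rpow_nonneg hX0 _)
  have hAMGM := Real.geom_mean_le_arith_mean2_weighted hθ0.le h1θ0.le (mul_nonneg hL0.le hZ0) hM0
    (by ring : θ + (1 - θ) = 1)
  -- the exponents
  have e3 : 1 / (1 - θ) * (1 - θ) = 1 := by rw [one_div, inv_mul_cancel₀ h1θ0.ne']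
  have e4 : β * (1 - θ) = (2 * s + 1) / 4 := by
    rw [hβ, h1θ, div_mul_div_comm, div_eq_div_iff (by positivity) (by norm_num)]
    ring
  have hsX : Real.sqrt X ^ (s + 1 / 2) = X ^ ((2 * s + 1) / 4) := by
    rw [Real.sqrt_eq_rpow, ← Real.rpow_mul hX0]
    congr 1
    ring
  have hsZ : Real.sqrt Z ^ (5 / 2 - s) = Z ^ θ := by
    rw [Real.sqrt_eq_rpow, ← Real.rpow_mul hZ0, hθ]
    congr 1
    ring
  -- `K X^{(2s+1)/4} Z^θ = (L Z)^θ · M^{1−θ}`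
  have hid : (L * Z) ^ θ * M ^ (1 - θ) = K * X ^ ((2 * s + 1) / 4) * Z ^ θ := by
    rw [hM, Real.mul_rpow hL0.le hZ0,
      Real.mul_rpow (Real.rpow_nonneg hKL0 _) (Real.rpow_nonneg hX0 _), ← Real.rpow_mul hKL0,
      ← Real.rpow_mul hX0, e3, Real.rpow_one, e4, Real.rpow_neg hL0.le]
    calc L ^ θ * Z ^ θ * (K * (L ^ θ)⁻¹ * X ^ ((2 * s + 1) / 4))
        = K * X ^ ((2 * s + 1) / 4) * Z ^ θ * (L ^ θ * (L ^ θ)⁻¹) := by ring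
      _ = K * X ^ ((2 * s + 1) / 4) * Z ^ θ := by rw [mul_inv_cancel₀ hLθ.ne', mul_one]
  -- `M = c ν^{−(5−2s)/(2s−1)} X^β`
  have hs1' : 2 * s - 1 ≠ 0 := hs1.ne'
  have e5 : -θ * (1 / (1 - θ)) = -((5 - 2 * s) / (2 * s - 1)) := by
    rw [h1θ, hθ]
    field_simp
  have hMc : M = c * ν ^ (-((5 - 2 * s) / (2 * s - 1))) * X ^ β := by
    rw [hM, hc, hL, Real.mul_rpow (by positivity : (0 : ℝ) ≤ 4 * Real.pi ^ 2) hν.le, ← mul_assoc,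
      Real.mul_rpow (mul_nonneg hK0 (Real.rpow_nonneg (by positivity) _)) (Real.rpow_nonneg hν.le _),
      ← Real.rpow_mul hν.le, e5]
  calc -(8 * Real.pi ^ 2 * ν) * Z + K * Real.sqrt X ^ (s + 1 / 2) * Real.sqrt Z ^ (5 / 2 - s)
      = -(8 * Real.pi ^ 2 * ν) * Z + (L * Z) ^ θ * M ^ (1 - θ) := by rw [hsX, hsZ, hid]
    _ ≤ -(8 * Real.pi ^ 2 * ν) * Z + (θ * (L * Z) + (1 - θ) * M) := by linarith [hAMGM]
    _ ≤ -(8 * Real.pi ^ 2 * ν) * Z + (L * Z + M) := by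
        nlinarith [mul_nonneg hL0.le hZ0, hM0, hθ0, h1θ0]
    _ = -(4 * Real.pi ^ 2 * ν) * Z + c * ν ^ (-((5 - 2 * s) / (2 * s - 1))) * X ^ β := by
        rw [hMc, hL]
        ring

/-- **The `Ḣ^s` growth-rate law, `1/2 < s < 3/2`** (Robinson–Sadowski–Silva 2012, §IV) — the
original range of this file; the case `s < 3/2` of `NSSobolev.hsSeminorm_sq_deriv_le_rpow'`.
[cite: RobinsonSadowskiSilva2012, §IV (display after "Application of Young's inequality")] -/
theorem hsSeminorm_sq_deriv_le_rpow (hd : Fintype.card d = 3) {s : ℝ} (hs : 1 / 2 < s)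
    (hs' : s < 3 / 2) :
    ∃ c : ℝ, 0 ≤ c ∧ ∀ {ν a b : ℝ}, 0 < ν → a < b →
      ∀ {u : ℝ → UnitAddTorus d → EuclideanSpace ℝ d} {p : ℝ → UnitAddTorus d → ℝ},
      IsClassicalNSSolutionOn (Icc a b) ν 0 u p → (∀ t ∈ Icc a b, HasZeroMean (u t)) →
      ∀ t ∈ Ioo a b, ∃ D : ℝ,
        HasDerivAt (fun τ => ∑' k : d → ℤ,
          freqNormSq k ^ s * ‖mFourierCoeff (EuclideanSpace.complexify ∘ u τ) k‖ ^ 2) D t ∧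
        D ≤ -(4 * Real.pi ^ 2 * ν) *
              (∑' k : d → ℤ, freqNormSq k ^ (s + 1) *
                ‖mFourierCoeff (EuclideanSpace.complexify ∘ u t) k‖ ^ 2) +
            c * ν ^ (-((5 - 2 * s) / (2 * s - 1))) *
              (∑' k : d → ℤ, freqNormSq k ^ s *
                ‖mFourierCoeff (EuclideanSpace.complexify ∘ u t) k‖ ^ 2) ^
                  ((2 * s + 1) / (2 * s - 1)) :=
  hsSeminorm_sq_deriv_le_rpow' hd hs (by linarith) hs'.ne

end NSSobolev

end Literature.Analysis.FluidPDE

end
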